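import Mathlib
import HarnessLib

/-!
# A bounded field invariant under a contracting rescaling vanishes:
# exactly (discretely) self-similar blow-up admits no bounded a-posteriori force near the singularity

HONEST FRAMING (cell `ns-blowup`, seat `ns-blowup-ecbridge-2` g0, human ruling D-0035): this cell
ATTEMPTS the negative direction of the Clay problem; nothing in this file is a claim about
Navier–Stokes. WHAT THIS IS NOT: not a statement about any PDE. It is the SCALING STEP of the
refuter's "EXACT-ANSATZ" audit (KILLSHEET §V.0, cell file `run/shared/lean/pub/ns-blowup/KILLSHEET.md`),
made kernel-grade, for the `E–C` endpoint question "can the a-posteriori force of a blow-up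
construction be smooth (hence bounded) THROUGH the blow-up time `T*`?".

The audit's argument. Near a putative singular point, translate it to the space–time origin and let
`(u, p)` be EXACTLY backward self-similar, or discretely self-similar with one factor `λ ∈ (0, 1)`:
`u(t, x) = λ u(λ²t, λx)`, `p(t, x) = λ² p(λ²t, λx)` on a backward parabolic neighbourhood
`Q_r = (-r², 0) × B_r`. Every term of `N(u, p) := ∂ₜu + (u·∇)u - νΔu + ∇p` then rescales with the
factor `λ³`, so the a-posteriori force `f := N(u, p)` satisfies `f(z) = λ³ f(δ_λ z)`,
`δ_λ(t, x) = (λ²t, λx)` (if only `u` is self-similar, `curl f` satisfies the same with `λ⁴`). The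
present file proves the elementary consequence: a field `g` on a set `S` mapped into itself by a map
`φ` with `g = c • (g ∘ φ)` on `S`, `‖c‖ < 1`, and `g` bounded on `S`, vanishes on `S`
(`eq_zero_of_eq_smul_comp_of_bounded`: iterate, `‖g z‖ ≤ ‖c‖ⁿ M → 0`); for the parabolic dilation
`δ_λ` of a backward cylinder `Q_r` (which `δ_λ` maps into itself) this gives
`eq_zero_on_backwardCylinder_of_dss_of_bounded`, and boundedness is only needed near the vertex:
continuity of `g` at the space–time origin suffices (`eq_zero_on_backwardCylinder_of_dss_of_continuousAt`).
So a force that is smooth — or merely continuous at `(T*, x₀)` — and compatible with an exactly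
(discretely) self-similar blow-up VANISHES identically on a backward parabolic neighbourhood of the
singular point: the construction is locally UNFORCED there, and every local unforced exclusion of
exact self-similarity (Tsai 1998 Thm. 2, Chae 2007 Cor. 1.3, Nečas–Růžička–Šverák 1996; tree:
`tsai_selfsimilar_local_energy_holds` and relatives) applies verbatim. The rescaling identity
`N(u,p) ∘` (self-similar pair) `= λ⁻³ …` itself is NOT formalised here (it is the refuter's EXACT,
referee-grade step); this file is the part that turns "self-similar of negative degree and bounded"
into "zero".

Typed:
* `eq_zero_of_eq_smul_comp_of_bounded` — abstract contraction lemma on an invariant set.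
* `mapsTo_parabolicDilation_backwardCylinder` — `δ_λ` maps `Q_r = (-r², 0) × B_r(0)` into itself for
  `0 < λ ≤ 1` (sets and maps written inline; no new definitions).
* `eq_zero_on_backwardCylinder_of_dss_of_bounded` — `g z = λ^d • g(δ_λ z)` on `Q_r`, `0 < λ < 1`,
  `0 < d`, `g` bounded on `Q_r` ⇒ `g = 0` on `Q_r`.
* `eq_zero_on_backwardCylinder_of_dss_of_continuousAt` — the same with "bounded on `Q_r`" replaced by
  "continuous at the vertex `(0, 0)`".
-/

namespace Summit.NavierStokesRegularity.FluidComputer.SelfSimilarForceVanishing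

open Set Filter Topology

variable {X : Type*} {F : Type*} [NormedAddCommGroup F] [NormedSpace ℝ F]

/-- **Contraction lemma.** If `φ` maps `S` into itself, `g = c • (g ∘ φ)` on `S` with `|c| < 1`, and
`g` is bounded on `S`, then `g = 0` on `S`: iterating, `g z = cⁿ • g (φ^[n] z)`, so
`‖g z‖ ≤ |c|ⁿ M → 0`. -/
theorem eq_zero_of_eq_smul_comp_of_bounded {S : Set X} {φ : X → X} (hφ : MapsTo φ S S) {c : ℝ}
    (hc : |c| < 1) {g : X → F} (hg : ∀ z ∈ S, g z = c • g (φ z)) {M : ℝ}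
    (hM : ∀ z ∈ S, ‖g z‖ ≤ M) : ∀ z ∈ S, g z = 0 := by
  -- iterate the functional equation
  have hiter : ∀ n : ℕ, ∀ z ∈ S, g z = c ^ n • g (φ^[n] z) := by
    intro n
    induction n with
    | zero => intro z _; simp
    | succ n ih =>
      intro z hz
      rw [ih z hz, hg _ (hφ.iterate n hz), smul_smul, ← pow_succ, Function.iterate_succ_apply']
  intro z hz
  have hM0 : 0 ≤ M := (norm_nonneg _).trans (hM z hz)
  -- `‖g z‖ ≤ |c|^n M` for every `n`, and the right-hand side tends to `0`
  have hbound : ∀ n : ℕ, ‖g z‖ ≤ |c| ^ n * M := by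
    intro n
    rw [hiter n z hz, norm_smul, norm_pow, Real.norm_eq_abs]
    exact mul_le_mul_of_nonneg_left (hM _ (hφ.iterate n hz)) (pow_nonneg (abs_nonneg c) n)
  have hlim : Tendsto (fun n : ℕ => |c| ^ n * M) atTop (𝓝 0) := by
    simpa using (tendsto_pow_atTop_nhds_zero_of_lt_one (abs_nonneg c) hc).mul_const M
  have h0 : ‖g z‖ ≤ 0 := ge_of_tendsto' hlim hbound
  exact norm_le_zero_iff.1 h0

variable {E : Type*} [NormedAddCommGroup E] [NormedSpace ℝ E]

/-- The parabolic dilation `δ_λ (t, x) = (λ² t, λ x)` maps the backward parabolic cylinder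
`Q_r = (-r², 0) × B_r(0)` (vertex at the space–time origin) into itself when `0 < λ ≤ 1`. -/
theorem mapsTo_parabolicDilation_backwardCylinder {l : ℝ} (hl0 : 0 < l) (hl1 : l ≤ 1) (r : ℝ) :
    MapsTo (fun z : ℝ × E => (l ^ 2 * z.1, l • z.2))
      (Ioo (-(r ^ 2)) 0 ×ˢ Metric.ball (0 : E) r) (Ioo (-(r ^ 2)) 0 ×ˢ Metric.ball (0 : E) r) := by
  intro z hz
  obtain ⟨⟨ht1, ht2⟩, hx⟩ := hz
  rw [Metric.mem_ball, dist_zero_right] at hx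
  have hl2 : 0 < l ^ 2 := by positivity
  have hl2' : l ^ 2 ≤ 1 := pow_le_one₀ hl0.le hl1
  refine ⟨⟨?_, ?_⟩, ?_⟩
  · -- `-(r²) < l² t` since `l² t ≥ t > -r²` (`t < 0`, `l² ≤ 1`)
    nlinarith
  · exact mul_neg_of_pos_of_neg hl2 ht2
  · rw [Metric.mem_ball, dist_zero_right, norm_smul, Real.norm_of_nonneg hl0.le]
    calc l * ‖z.2‖ ≤ 1 * ‖z.2‖ := mul_le_mul_of_nonneg_right hl1 (norm_nonneg _)
      _ < r := by rw [one_mul]; exact hx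

/-- **Exactly (discretely) self-similar and bounded ⇒ zero.** Let `0 < λ < 1`, `0 < d`, and let
`g : ℝ × E → F` satisfy the discrete self-similarity of NEGATIVE degree
`g (t, x) = λ^d • g (λ² t, λ x)` on the backward cylinder `Q_r = (-r², 0) × B_r(0)`. If `g` is bounded
on `Q_r` then `g = 0` on `Q_r`. (Application, cell `ns-blowup` KILLSHEET §V.0: the a-posteriori force
`f = ∂ₜu + (u·∇)u - νΔu + ∇p` of an exactly backward (discretely) self-similar pair `(u, p)` has
`d = 3`, its curl `d = 4` if only `u` is self-similar; a bounded — a fortiori smooth — such force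
vanishes near the singular point, so the blow-up is locally unforced.) -/
theorem eq_zero_on_backwardCylinder_of_dss_of_bounded {l d r : ℝ} (hl0 : 0 < l) (hl1 : l < 1)
    (hd : 0 < d) {g : ℝ × E → F}
    (hg : ∀ z ∈ Ioo (-(r ^ 2)) 0 ×ˢ Metric.ball (0 : E) r, g z = (l ^ d) • g (l ^ 2 * z.1, l • z.2))
    {M : ℝ} (hM : ∀ z ∈ Ioo (-(r ^ 2)) 0 ×ˢ Metric.ball (0 : E) r, ‖g z‖ ≤ M) :
    ∀ z ∈ Ioo (-(r ^ 2)) 0 ×ˢ Metric.ball (0 : E) r, g z = 0 := by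
  have hc : |l ^ d| < 1 := by
    rw [abs_of_pos (Real.rpow_pos_of_pos hl0 d)]
    exact Real.rpow_lt_one hl0.le hl1 hd
  exact eq_zero_of_eq_smul_comp_of_bounded (mapsTo_parabolicDilation_backwardCylinder hl0 hl1.le r)
    hc (fun z hz => hg z hz) hM

/-- **Exactly (discretely) self-similar and continuous at the vertex ⇒ zero.** As
`eq_zero_on_backwardCylinder_of_dss_of_bounded`, with boundedness on `Q_r` replaced by continuity of
`g` at the space–time origin (the vertex of `Q_r`): `g` is then bounded on a small cylinder `Q_ρ`,
vanishes there, and every point of `Q_r` is carried into `Q_ρ` by an iterate of the dilation, along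
which `g` only changes by the factor `λ^{dn}`. In the cell's words: a force that is merely CONTINUOUS
at `(T*, x₀)` is incompatible with an exactly (discretely) self-similar blow-up at `(T*, x₀)` unless
it vanishes identically on a backward parabolic neighbourhood. -/
theorem eq_zero_on_backwardCylinder_of_dss_of_continuousAt {l d r : ℝ} (hl0 : 0 < l) (hl1 : l < 1)
    (hd : 0 < d) {g : ℝ × E → F}
    (hg : ∀ z ∈ Ioo (-(r ^ 2)) 0 ×ˢ Metric.ball (0 : E) r, g z = (l ^ d) • g (l ^ 2 * z.1, l • z.2))
    (hcont : ContinuousAt g (0, 0)) :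
    ∀ z ∈ Ioo (-(r ^ 2)) 0 ×ˢ Metric.ball (0 : E) r, g z = 0 := by
  set Q : ℝ → Set (ℝ × E) := fun ρ => Ioo (-(ρ ^ 2)) 0 ×ˢ Metric.ball (0 : E) ρ with hQ
  set φ : ℝ × E → ℝ × E := fun z => (l ^ 2 * z.1, l • z.2) with hφ
  -- `g` is bounded near the vertex: `‖g w‖ ≤ ‖g 0‖ + 1` on a ball of radius `ε`
  have hnhds : ∀ᶠ w in 𝓝 ((0 : ℝ), (0 : E)), dist (g w) (g (0, 0)) < 1 :=
    hcont (Metric.ball_mem_nhds _ one_pos)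
  obtain ⟨ε, hε, hball⟩ := Metric.eventually_nhds_iff.1 hnhds
  -- choose `ρ > 0` with `Q_ρ ⊆ B_ε(0) ∩ Q_r`… we only need `Q_ρ ⊆ B_ε` and `ρ ≤ r` is not needed:
  -- the small cylinder is intersected with `Q_r` below through the iterates.
  obtain ⟨ρ, hρ0, hρε, hρ1⟩ : ∃ ρ : ℝ, 0 < ρ ∧ ρ < ε / 2 ∧ ρ ≤ 1 :=
    ⟨min (ε / 4) 1, by positivity, by
      have : min (ε / 4) 1 ≤ ε / 4 := min_le_left _ _; linarith, min_le_right _ _⟩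
  have hQρ_sub : Q ρ ⊆ Metric.ball ((0 : ℝ), (0 : E)) ε := by
    intro w hw
    obtain ⟨⟨hw1, hw2⟩, hw3⟩ := hw
    rw [Metric.mem_ball, dist_zero_right] at hw3
    rw [Metric.mem_ball, Prod.dist_eq, dist_zero_right, dist_zero_right, max_lt_iff]
    have hρ2 : ρ ^ 2 ≤ ρ := by nlinarith
    constructor
    · rw [Real.norm_eq_abs, abs_lt]; constructor <;> nlinarith
    · linarith
  -- on `Q_r ∩ Q_ρ` the functional equation holds and `g` is bounded, so `g = 0` there
  have hmaps : MapsTo φ (Q r ∩ Q ρ) (Q r ∩ Q ρ) := fun z hz =>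
    ⟨mapsTo_parabolicDilation_backwardCylinder hl0 hl1.le r hz.1,
      mapsTo_parabolicDilation_backwardCylinder hl0 hl1.le ρ hz.2⟩
  have hc : |l ^ d| < 1 := by
    rw [abs_of_pos (Real.rpow_pos_of_pos hl0 d)]
    exact Real.rpow_lt_one hl0.le hl1 hd
  have hzero : ∀ z ∈ Q r ∩ Q ρ, g z = 0 :=
    eq_zero_of_eq_smul_comp_of_bounded hmaps hc (fun z hz => hg z hz.1)
      (M := ‖g (0, 0)‖ + 1) (fun z hz => by
        have h := hball (hQρ_sub hz.2)
        rw [dist_eq_norm] at h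
        calc ‖g z‖ = ‖(g z - g (0, 0)) + g (0, 0)‖ := by rw [sub_add_cancel]
          _ ≤ ‖g z - g (0, 0)‖ + ‖g (0, 0)‖ := norm_add_le _ _
          _ ≤ ‖g (0, 0)‖ + 1 := by linarith)
  -- every `z ∈ Q_r` is carried into `Q_ρ` by some iterate of `φ`
  have hiter_fe : ∀ n : ℕ, ∀ z ∈ Q r, g z = (l ^ d) ^ n • g (φ^[n] z) := by
    intro n
    induction n with
    | zero => intro z _; simp
    | succ n ih =>
      intro z hz
      rw [ih z hz, hg _ ((mapsTo_parabolicDilation_backwardCylinder hl0 hl1.le r).iterate n hz),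
        smul_smul, ← pow_succ, Function.iterate_succ_apply']
  have hiter_formula : ∀ n : ℕ, ∀ z : ℝ × E, φ^[n] z = ((l ^ 2) ^ n * z.1, (l ^ n) • z.2) := by
    intro n
    induction n with
    | zero => intro z; simp
    | succ n ih =>
      intro z
      rw [Function.iterate_succ_apply', ih]
      simp only [hφ, smul_smul, Prod.mk.injEq]
      constructor
      · ring
      · rw [pow_succ, mul_comm]
  intro z hz
  obtain ⟨⟨hz1, hz2⟩, hz3⟩ := hz
  rw [Metric.mem_ball, dist_zero_right] at hz3
  -- `(l²)ⁿ |t| → 0` and `lⁿ ‖x‖ → 0`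
  have hl2lt : l ^ 2 < 1 := by nlinarith
  have ht : Tendsto (fun n : ℕ => (l ^ 2) ^ n * |z.1|) atTop (𝓝 0) := by
    simpa using (tendsto_pow_atTop_nhds_zero_of_lt_one (by positivity) hl2lt).mul_const |z.1|
  have hx : Tendsto (fun n : ℕ => l ^ n * ‖z.2‖) atTop (𝓝 0) := by
    simpa using (tendsto_pow_atTop_nhds_zero_of_lt_one hl0.le hl1).mul_const ‖z.2‖
  have hρ2 : 0 < ρ ^ 2 := by positivity
  obtain ⟨N₁, hN₁⟩ := (ht.eventually (gt_mem_nhds hρ2)).exists_forall_of_atTop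
  obtain ⟨N₂, hN₂⟩ := (hx.eventually (gt_mem_nhds hρ0)).exists_forall_of_atTop
  set n := max N₁ N₂ with hn
  have hmem : φ^[n] z ∈ Q r ∩ Q ρ := by
    refine ⟨(mapsTo_parabolicDilation_backwardCylinder hl0 hl1.le r).iterate n ⟨⟨hz1, hz2⟩, ?_⟩, ?_⟩
    · rwa [Metric.mem_ball, dist_zero_right]
    · rw [hiter_formula n z]
      have h1 := hN₁ n (le_max_left _ _)
      have h2 := hN₂ n (le_max_right _ _)
      have hpos : 0 < (l ^ 2) ^ n := by positivity
      refine ⟨⟨?_, mul_neg_of_pos_of_neg hpos hz2⟩, ?_⟩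
      · have : (l ^ 2) ^ n * |z.1| = -((l ^ 2) ^ n * z.1) := by
          rw [abs_of_neg hz2]; ring
        linarith
      · rw [Metric.mem_ball, dist_zero_right, norm_smul, norm_pow, Real.norm_of_nonneg hl0.le]
        exact h2
  rw [hiter_fe n z ⟨⟨hz1, hz2⟩, by rwa [Metric.mem_ball, dist_zero_right]⟩, hzero _ hmem, smul_zero]

end Summit.NavierStokesRegularity.FluidComputer.SelfSimilarForceVanishing
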